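/-
Copyright: the b2b-balaban T⁴-continuum CRUX team, row NE7b, leaf lineage `t4-ne7b-formalise-leaf-02` (gen 132). Project licence.
-/
import Literature.MathematicalPhysics.QuantumFieldTheory.Balaban1983to89.B7Eq47AveragedBondVsStraight
import Summits.QuantumFields.BalabanUV.T4Continuum.Spine.NE7b.OneStepLoopLetters

/-!
# THE THREE LOOP LETTERS OF LEMMA CS (ii) AT ONE STEP, II — BY VALUE: the block loops of part I ARE [B7]'s `W(c, x) = V(Γ_{c,x})V(c)⁻¹` ((42),
# `B7Prop1Explicit.Wcx` in four factors), so under the plaquette regularity (44)∕(109) with `V = V̄₀` and a `U(N)`-type background,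
# `δ₂ ≤ 80(d+1)(d+4)L²α₀`, `δ₃ ≤ 240(d+1)(d+4)L²α₀`, `δ₄ ≤ 320(d+1)(d+4)L²α₀` (`w = 16(d+1)(d+4)L²α₀`: `B7Prop2Explicit.norm_Wcx_sub_one_le`;
# `ε_V = 64(d+1)(d+4)L²α₀`: `B7Eq47AveragedBondVsStraight.norm_bavg_sub_straight_le_of_pdev`) — VERBATIM the `hδ₂ ∕ hδ₃ ∕ hδ₄` hypotheses of
# `…OneStepCovariantStokes.norm_coarseCurl_Q0cov_le`: the memo's `c_g ε_F` at `k = 1` BY VALUE (row NE7b, node U5c; `SectE-interface-proof.md` §5.2 (ii))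

Cell `pub-balaban`, sub-cell `t4`, spine estimate NE7b (`T4WeightBudget.RelWeightBound`; the cell's OWN estimate — NOT PRINTED in
[Bałaban 1983–89], NOT PROVED).  Crux-route work under `Spine/NE7b/` by the row's E-side ∕ key-readings ∕ lattice-geometry leaf lineage; NOTHING
of Bałaban's is asserted beyond what the imported Literature modules prove; no `T4Continuum/Support` leaf typed; no `def`, no notation; zero `sorry`.
Imports, REUSED BY NAME: part I `…OneStepLoopLetters` (this lineage: `delta2_le ∕ delta3_le ∕ delta4_le`) and `Literature.….B7Eq47AveragedBondVsStraight`
(NE9 leaf-03: `norm_bavg_sub_straight_le_of_pdev`; through it `B7Prop2Explicit.norm_Wcx_sub_one_le ∕ bavg_mem_unitaryUnits ∕ unitaryUnits_le_U1` and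
`B7Prop1Explicit.Wcx ∕ gammaWord ∕ bavg ∕ hol_mem`).

WHAT IS PROVED ([folklore]; `𝔸` a normed ring for §1, a non-trivial C⋆-algebra for §2 — print's `G ⊂ U(N) ⊂ M_N(ℂ)`):
* §1 **`Wcx_eq_four`** — [B7]'s block loop in four factors: `W(c, x) = V(Γ_{q,x})·V([x, x+Le_κ])·V(Γ_{q+Le_κ, x+Le_κ})⁻¹·V([q, q+Le_κ])⁻¹` for
  `c = ⟨q, q+Le_κ⟩`, `x = q + r` (`gammaWord`, `hol_append`, `hol_revWord'`) — so part I's `W₁ … W₄` are `Wcx` at `(q, κ)`, `(q+Le_κ, μ)`, `(q+Le_μ, κ)`,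
  `(q, μ)` with the same offset `r`.
* §2 BY VALUE under (44)∕(109) (`‖V₀(∂p) − 1‖ ≤ α₀` on `ℤ^d`, `512(d+1)(d+4)L²α₀ ≤ 1`, `1 ≤ L`), `V₀` unitary-valued, coarse bond variables the AVERAGES
  `uᵢ = V̄₀(cᵢ)` (`B7Prop1Explicit.bavg`): `bavg_mem_U1_of_pdev` (the averages are unitary, hence in the unit ball), **`delta2_le_of_pdev`**
  (`≤ 80(d+1)(d+4)L²α₀`), **`delta3_le_of_pdev`** (`≤ 240(d+1)(d+4)L²α₀`), **`delta4_le_of_pdev`** (`≤ 320(d+1)(d+4)L²α₀`) — VERBATIM the `hδᵢ` of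
  `OneStepCovariantStokes.norm_coarseCurl_Q0cov_le` at `V = V̄₀`, all dominated by `δ := 320(d+1)(d+4)L²α₀` (`2δ` = the memo's `c_g ε_F` at `k = 1`).

NOT HERE (honest): the junction with `…OneStepCovariantStokes` BY NAME (one `fun r => …` per letter once both oleans exist); `k > 1` (the tower:
`B7Eq47AveragedBondVsStraight.norm_avgIter_sub_straight_le` for `ε_V`, the per-level `Wcx` bound for `w`); step (i), the counting, (R-M), normalisations;
(A3) ∕ (A1c), NC-NE7b-α UNRULED.  BY-NAME EFFECT ON THE WALL: NONE.  NE7b NOT PRINTED ∕ NOT PROVED; spine PROVED 0∕9; rung (B)+1 on a FINITE torus —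
NOT infinite volume, NOT the mass gap, NOT Clay.
HONEST DEPENDENCY: continuum YM on T⁴ ⇐ BetaPertH ∧ nine spine estimates (0/9 proved); BetaPertH ⇐ (D1) ∧ (D4) ∧ CAP+tail; G-an2-4 gates
asym, D1 and NE2/3/4.
-/

set_option autoImplicit false

noncomputable section

open Literature.MathematicalPhysics.QuantumFieldTheory.Balaban1983to89
open Literature.MathematicalPhysics.QuantumFieldTheory.Balaban1983to89.B7Prop1Explicit
  (Site e hol hol_append hol_revWord' seg treeWord boxVec gammaWord disp disp_append disp_treeWord disp_seg Wcx bavg plaqWord U1 mem_U1 hol_mem)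
open Summit.QuantumFields.BalabanUV.T4Continuum.NE7b.OneStepLoopLetters (delta2_le delta3_le delta4_le)

namespace Summit.QuantumFields.BalabanUV.T4Continuum.NE7b.OneStepLoopLettersValue

variable {d : ℕ}
variable {𝔸 : Type*} [NormedRing 𝔸] [NormOneClass 𝔸]

/-! ## §1 [B7]'s block loop (42) in four factors -/

section BlockLoop

variable (L : ℕ) (V₀ : Site d → Fin d → 𝔸ˣ)

omit [NormOneClass 𝔸] in
/-- **`W(c, x) = V(Γ_{q,x})·V([x, x+Le_κ])·V(Γ_{q+Le_κ, x+Le_κ})⁻¹·V([q, q+Le_κ])⁻¹`** for `c = ⟨q, q+Le_κ⟩`, `x = q + r` — [B7]'s `Wcx` ((42): `V(Γ_{c,x})V(c)⁻¹`,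
`Γ_{c,x} = Γ_{q,x} ∪ [x, x+Le_κ] ∪ (−Γ_{q+Le_κ, x+Le_κ})`). [folklore] -/
theorem Wcx_eq_four (q : Site d) (κ : Fin d) (r : Site d) :
    Wcx L V₀ q κ r = hol V₀ q (treeWord r) * hol V₀ (q + r) (seg κ L) * (hol V₀ (q + (L : ℤ) • e κ) (treeWord r))⁻¹
      * (hol V₀ q (seg κ L))⁻¹ := by
  unfold Wcx gammaWord
  rw [hol_append, hol_append, disp_append, disp_treeWord, disp_seg,
    hol_revWord' V₀ (x := q + (L : ℤ) • e κ) (q + (r + (L : ℤ) • e κ)) (treeWord r) (by rw [disp_treeWord]; abel)]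

end BlockLoop

/-! ## §2 By value under the plaquette regularity (44)∕(109), coarse bond variables = the averages `V̄₀` -/

section ByValue

variable {𝔹 : Type*} [CStarAlgebra 𝔹] [Nontrivial 𝔹]
variable (L : ℕ) {V₀ : Site d → Fin d → 𝔹ˣ} (hV₀ : ∀ x κ, V₀ x κ ∈ B7Prop2Explicit.unitaryUnits 𝔹) (hL : 1 ≤ L) {α₀ : ℝ}
  (hα₀ : 0 ≤ α₀) (hsmall : 512 * (d + 1) * (d + 4) * (L : ℝ) ^ 2 * α₀ ≤ 1)
  (h44 : ∀ (x : Site d) (κ κ' : Fin d), κ ≠ κ' → ‖((hol V₀ x (plaqWord κ κ') : 𝔹ˣ) : 𝔹) - 1‖ ≤ α₀)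

include hV₀ hL hα₀ hsmall h44 in
/-- Under (44) with `512(d+1)(d+4)L²α₀ ≤ 1` the averages `V̄₀(c)` of a `U(N)`-type configuration are unitary, hence in the unit ball
(`B7Prop2Explicit.bavg_mem_unitaryUnits` + `unitaryUnits_le_U1`; the block loops are within `16(d+1)(d+4)L²α₀ ≤ 1∕32` of `1`). [folklore] -/
theorem bavg_mem_U1_of_pdev (q : Site d) (κ : Fin d) : bavg L V₀ q κ ∈ U1 𝔹 := by
  have hV₀' : ∀ x κ, V₀ x κ ∈ U1 𝔹 := fun x κ => B7Prop2Explicit.unitaryUnits_le_U1 (hV₀ x κ)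
  refine B7Prop2Explicit.unitaryUnits_le_U1 (B7Prop2Explicit.bavg_mem_unitaryUnits hV₀ L q κ fun r => ?_)
  refine (B7Prop2Explicit.norm_Wcx_sub_one_le L hL V₀ hV₀' hα₀ hsmall h44 q κ r).trans ?_
  have hx : (0 : ℝ) ≤ (d + 1) * (d + 4) * (L : ℝ) ^ 2 * α₀ := by positivity
  nlinarith

include hV₀ hL hα₀ hsmall h44 in
/-- **`δ₂ ≤ 80(d+1)(d+4)L²α₀`** at every block point, for `u₁ = V̄₀(c₁)`: `w = 2·8(d+1)(d+4)L²α₀` (`B7Prop2Explicit.norm_Wcx_sub_one_le`) plus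
`ε_V = 64(d+1)(d+4)L²α₀` (`B7Eq47AveragedBondVsStraight.norm_bavg_sub_straight_le_of_pdev`) — VERBATIM the `hδ₂` shape of
`OneStepCovariantStokes.norm_coarseCurl_Q0cov_le`. [folklore] -/
theorem delta2_le_of_pdev (q : Site d) (κ : Fin d) (r : Fin d → Fin L) :
    ‖((((hol V₀ q (treeWord (boxVec L r)) * hol V₀ (q + boxVec L r) (seg κ L))⁻¹
        * (bavg L V₀ q κ * hol V₀ (q + (L : ℤ) • e κ) (treeWord (boxVec L r))) : 𝔹ˣ)) : 𝔹) - 1‖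
      ≤ 80 * (d + 1) * (d + 4) * (L : ℝ) ^ 2 * α₀ := by
  have hV₀' : ∀ x κ, V₀ x κ ∈ U1 𝔹 := fun x κ => B7Prop2Explicit.unitaryUnits_le_U1 (hV₀ x κ)
  have hW := B7Prop2Explicit.norm_Wcx_sub_one_le L hL V₀ hV₀' hα₀ hsmall h44 q κ r
  rw [Wcx_eq_four] at hW
  have hu := B7Eq47AveragedBondVsStraight.norm_bavg_sub_straight_le_of_pdev L hL hV₀' hα₀ hsmall h44 q κ
  have h := delta2_le (hol_mem hV₀' _ _) (hol_mem hV₀' _ _) (hol_mem hV₀' _ _) (hol_mem hV₀' _ _) hW hu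
  refine h.trans (le_of_eq ?_)
  ring

include hV₀ hL hα₀ hsmall h44 in
/-- **`δ₃ ≤ 240(d+1)(d+4)L²α₀`** at every block point, for `uᵢ = V̄₀(cᵢ)`: three block loops + three substitutions — VERBATIM the `hδ₃` shape of
`OneStepCovariantStokes.norm_coarseCurl_Q0cov_le`. [folklore] -/
theorem delta3_le_of_pdev (q : Site d) (κ μ : Fin d) (r : Fin d → Fin L) :
    ‖((((hol V₀ q (treeWord (boxVec L r)) * (hol V₀ (q + boxVec L r) (seg κ L)
          * hol V₀ (q + boxVec L r + (L : ℤ) • e κ) (seg μ L) * (hol V₀ (q + boxVec L r + (L : ℤ) • e μ) (seg κ L))⁻¹))⁻¹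
        * (bavg L V₀ q κ * bavg L V₀ (q + (L : ℤ) • e κ) μ * (bavg L V₀ (q + (L : ℤ) • e μ) κ)⁻¹
          * hol V₀ (q + (L : ℤ) • e μ) (treeWord (boxVec L r))) : 𝔹ˣ)) : 𝔹) - 1‖
      ≤ 240 * (d + 1) * (d + 4) * (L : ℝ) ^ 2 * α₀ := by
  have e2 : q + (L : ℤ) • e κ + boxVec L r = q + boxVec L r + (L : ℤ) • e κ := by abel
  have e3 : q + (L : ℤ) • e μ + boxVec L r = q + boxVec L r + (L : ℤ) • e μ := by abel
  have e23 : q + (L : ℤ) • e μ + (L : ℤ) • e κ = q + (L : ℤ) • e κ + (L : ℤ) • e μ := by abel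
  have hV₀' : ∀ x κ, V₀ x κ ∈ U1 𝔹 := fun x κ => B7Prop2Explicit.unitaryUnits_le_U1 (hV₀ x κ)
  have hW₁ := B7Prop2Explicit.norm_Wcx_sub_one_le L hL V₀ hV₀' hα₀ hsmall h44 q κ r
  have hW₂ := B7Prop2Explicit.norm_Wcx_sub_one_le L hL V₀ hV₀' hα₀ hsmall h44 (q + (L : ℤ) • e κ) μ r
  have hW₃ := B7Prop2Explicit.norm_Wcx_sub_one_le L hL V₀ hV₀' hα₀ hsmall h44 (q + (L : ℤ) • e μ) κ r
  rw [Wcx_eq_four] at hW₁ hW₂ hW₃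
  rw [e2] at hW₂
  rw [e3, e23] at hW₃
  have hu₁ := B7Eq47AveragedBondVsStraight.norm_bavg_sub_straight_le_of_pdev L hL hV₀' hα₀ hsmall h44 q κ
  have hu₂ := B7Eq47AveragedBondVsStraight.norm_bavg_sub_straight_le_of_pdev L hL hV₀' hα₀ hsmall h44 (q + (L : ℤ) • e κ) μ
  have hu₃ := B7Eq47AveragedBondVsStraight.norm_bavg_sub_straight_le_of_pdev L hL hV₀' hα₀ hsmall h44 (q + (L : ℤ) • e μ) κ
  have hb := bavg_mem_U1_of_pdev L hV₀ hL hα₀ hsmall h44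
  have h := delta3_le (hol_mem hV₀' _ _) (hol_mem hV₀' _ _) (hol_mem hV₀' _ _) (hol_mem hV₀' _ _) (hol_mem hV₀' _ _)
    (hol_mem hV₀' _ _) (hol_mem hV₀' _ _) (hol_mem hV₀' _ _) (hol_mem hV₀' _ _) (hol_mem hV₀' _ _)
    (hb _ _) (hb _ _) (hb _ _) hW₁ hW₂ hW₃ hu₁ hu₂ hu₃
  refine h.trans (le_of_eq ?_)
  ring

include hV₀ hL hα₀ hsmall h44 in
/-- **`δ₄ ≤ 320(d+1)(d+4)L²α₀`** at every block point, for `uᵢ = V̄₀(cᵢ)`: four block loops + four substitutions — VERBATIM the `hδ₄` shape of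
`OneStepCovariantStokes.norm_coarseCurl_Q0cov_le`; `320(d+1)(d+4)L²α₀` dominates all three letters (`δ := 320(d+1)(d+4)L²α₀`). [folklore] -/
theorem delta4_le_of_pdev (q : Site d) (κ μ : Fin d) (r : Fin d → Fin L) :
    ‖((((hol V₀ q (treeWord (boxVec L r)) * (hol V₀ (q + boxVec L r) (seg κ L)
          * hol V₀ (q + boxVec L r + (L : ℤ) • e κ) (seg μ L) * (hol V₀ (q + boxVec L r + (L : ℤ) • e μ) (seg κ L))⁻¹
          * (hol V₀ (q + boxVec L r) (seg μ L))⁻¹))⁻¹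
        * (bavg L V₀ q κ * bavg L V₀ (q + (L : ℤ) • e κ) μ * (bavg L V₀ (q + (L : ℤ) • e μ) κ)⁻¹ * (bavg L V₀ q μ)⁻¹
          * hol V₀ q (treeWord (boxVec L r))) : 𝔹ˣ)) : 𝔹) - 1‖
      ≤ 320 * (d + 1) * (d + 4) * (L : ℝ) ^ 2 * α₀ := by
  have e2 : q + (L : ℤ) • e κ + boxVec L r = q + boxVec L r + (L : ℤ) • e κ := by abel
  have e3 : q + (L : ℤ) • e μ + boxVec L r = q + boxVec L r + (L : ℤ) • e μ := by abel
  have e23 : q + (L : ℤ) • e μ + (L : ℤ) • e κ = q + (L : ℤ) • e κ + (L : ℤ) • e μ := by abel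
  have hV₀' : ∀ x κ, V₀ x κ ∈ U1 𝔹 := fun x κ => B7Prop2Explicit.unitaryUnits_le_U1 (hV₀ x κ)
  have hW₁ := B7Prop2Explicit.norm_Wcx_sub_one_le L hL V₀ hV₀' hα₀ hsmall h44 q κ r
  have hW₂ := B7Prop2Explicit.norm_Wcx_sub_one_le L hL V₀ hV₀' hα₀ hsmall h44 (q + (L : ℤ) • e κ) μ r
  have hW₃ := B7Prop2Explicit.norm_Wcx_sub_one_le L hL V₀ hV₀' hα₀ hsmall h44 (q + (L : ℤ) • e μ) κ r
  have hW₄ := B7Prop2Explicit.norm_Wcx_sub_one_le L hL V₀ hV₀' hα₀ hsmall h44 q μ r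
  rw [Wcx_eq_four] at hW₁ hW₂ hW₃ hW₄
  rw [e2] at hW₂
  rw [e3, e23] at hW₃
  have hu₁ := B7Eq47AveragedBondVsStraight.norm_bavg_sub_straight_le_of_pdev L hL hV₀' hα₀ hsmall h44 q κ
  have hu₂ := B7Eq47AveragedBondVsStraight.norm_bavg_sub_straight_le_of_pdev L hL hV₀' hα₀ hsmall h44 (q + (L : ℤ) • e κ) μ
  have hu₃ := B7Eq47AveragedBondVsStraight.norm_bavg_sub_straight_le_of_pdev L hL hV₀' hα₀ hsmall h44 (q + (L : ℤ) • e μ) κ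
  have hu₄ := B7Eq47AveragedBondVsStraight.norm_bavg_sub_straight_le_of_pdev L hL hV₀' hα₀ hsmall h44 q μ
  have hb := bavg_mem_U1_of_pdev L hV₀ hL hα₀ hsmall h44
  have h := delta4_le (hol_mem hV₀' _ _) (hol_mem hV₀' _ _) (hol_mem hV₀' _ _) (hol_mem hV₀' _ _) (hol_mem hV₀' _ _)
    (hol_mem hV₀' _ _) (hol_mem hV₀' _ _) (hol_mem hV₀' _ _) (hol_mem hV₀' _ _) (hol_mem hV₀' _ _) (hol_mem hV₀' _ _)
    (hol_mem hV₀' _ _) (hb _ _) (hb _ _) (hb _ _) (hb _ _) hW₁ hW₂ hW₃ hW₄ hu₁ hu₂ hu₃ hu₄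
  refine h.trans (le_of_eq ?_)
  ring

end ByValue

end Summit.QuantumFields.BalabanUV.T4Continuum.NE7b.OneStepLoopLettersValue

end
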